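import Summits.CriticalPhenomena.PercolationContinuityZ3.Theorems.FK.PressureLipschitz
import Summits.CriticalPhenomena.PercolationContinuityZ3.Theorems.FK.FieldSaturation
import Literature.Probability.LatticeModels.SourcedDoubleCurrentsProofs
import HarnessLib

/-!
# STRICT ORDER STATEMENTS FOR THE ISING PRESSURE SURFACE: `β ↦ ψ(β,h)` is STRICTLY increasing on `[0,∞)` for
# every `h`, `h ↦ ψ(β,h)` is STRICTLY increasing in `|h|` for `β > 0`, hence `log 2 < ψ(β,h)` and `ψ(β,0) < ψ(β,h)`
# for `β > 0`, `h ≠ 0` (`d ≥ 1`)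
# (Friedli–Velenik 2017, Thm. 3.6, Exercise 3.12, §3.7; Griffiths 1967 (GKS))

Claimed R42 (8)(c) in the cell INBOX at 2026-08-29T04:48:56Z by fkp-10a gen 358 (NEW CLAIM #2 of the gen), addressed to coordinator fk-4 gen 292 (seated 04:05Z 2026-08-29 by l.8710; R166 in force); lineage row FO-10a-g358l (self-suggested), package g358-lipschitz, label SM-A.
Helper file of the `fk-continuity` build cell (bschramm lane; `--supports stmt-CriticalPhenomena-4575`); builds on
p205010 (kernel theorem, internal audit signed; external expert review pending). No definitions, no named facts, no
sorries; standard axioms. UNCONDITIONAL (nearest-neighbour Ising model on `ℤ^d`, `d ≥ 1`).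

The weak order statements are in `PressureLipschitz` (`monotoneOn_pressure_beta_field`, `monotoneOn_pressure_field_abs`).
Strictness comes from the strict positivity of the slopes: the `β`-chords of `ψ(·,h)` on `[β',β]` are
`≥ Σᵢ ⟨σ_0σ_{eᵢ}⟩⁺_{β',|h|} ≥ Σᵢ ⟨σ_0σ_{eᵢ}⟩^∅_{β',0} > 0` for `β' > 0` (GKS and the tree's `freeCorr_pos`), and the
`h`-chords of `ψ(β,·)` on `[s,t]`, `0 < s`, are `≥ β m(β,s) ≥ β tanh(βs) > 0` (`mul_magnetizationInField_le_slope_pressure`,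
`tanh_mul_le_magnetizationInField`).

* `sum_plusCorr_nn_pos` — `0 < Σᵢ ⟨σ_0σ_{eᵢ}⟩⁺_{β,h}` for `β > 0`, `h ≥ 0`, `d ≥ 1`;
* **`strictMonoOn_pressure_beta_field`** — `StrictMonoOn (fun b => ψ(b,h)) (Ici 0)` for every real `h`;
* **`log_two_lt_pressure`** — `log 2 = ψ(0,h) < ψ(β,h)` for every `β > 0` and every `h` (improving the mean-field
  criterion `βd > 1` of `PressureMeanFieldBound` and the weak bound `log 2 ≤ ψ` of `EntropyDensity`);
* **`strictMonoOn_pressure_field_Ici`** — `StrictMonoOn (fun t => ψ(β,t)) (Ici 0)` for `β > 0`;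
  `pressure_lt_pressure_of_abs_lt` — `ψ(β,h₁) < ψ(β,h₂)` whenever `|h₁| < |h₂|`; `pressure_zero_field_lt_pressure` —
  `ψ(β,0) < ψ(β,h)` for `h ≠ 0`; `pressure_injOn_field_Ici` — `ψ(β,·)` is injective on `[0,∞)`.

## References

* S. Friedli, Y. Velenik, *Statistical Mechanics of Lattice Systems*, CUP (2017), Thm. 3.6, Exercise 3.12, §3.7,
  Thm. 3.43. [FriedliVelenik2017]
* R. B. Griffiths, *Correlations in Ising ferromagnets I, II*, J. Math. Phys. 8 (1967) 478–489. [Griffiths1967]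
-/

noncomputable section

namespace Summit.CriticalPhenomena.PercolationContinuityZ3.Theorems.FK

namespace IsingPressure

open MeasureTheory Filter Topology Finset Set
open Literature.Probability.LatticeModels
open Summit.CriticalPhenomena.PercolationContinuityZ3.Theorems.FK.IsingEnergyDensity
open Summit.CriticalPhenomena.PercolationContinuityZ3.Theorems.FK.IsingSusceptibility

variable {d : ℕ}

/-! ### Strict positivity of the nearest-neighbour energy -/

/-- **`0 < Σᵢ ⟨σ_0σ_{eᵢ}⟩⁺_{β,h}`** for `d ≥ 1`, `β > 0`, `h ≥ 0` (`⟨σ_0σ_{eᵢ}⟩⁺_{β,h} ≥ ⟨σ_0σ_{eᵢ}⟩^∅_{β,0} > 0`, GKS and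
the tree's `freeCorr_pos`). [cite: FriedliVelenik2017, Exercise 3.12 and Thm. 3.6; Griffiths1967, Thm. 1] -/
theorem sum_plusCorr_nn_pos (hd : 1 ≤ d) {β h : ℝ} (hβ : 0 < β) (hh : 0 ≤ h) :
    0 < ∑ i, plusCorr d β h ({0, Pi.single i 1} : Finset (Site d)) := by
  have hi : ∀ i : Fin d, 0 < plusCorr d β h ({0, Pi.single i 1} : Finset (Site d)) := by
    intro i
    have hne : (0 : Site d) ≠ Pi.single i 1 := by
      intro h0
      have := congrFun h0 i
      simp at this
    have heven : Even #({0, Pi.single i 1} : Finset (Site d)) := by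
      rw [card_pair hne]; exact ⟨1, rfl⟩
    calc (0 : ℝ) < freeCorr d β 0 {0, Pi.single i 1} := freeCorr_pos (d := d) hβ heven
      _ ≤ plusCorr d β 0 {0, Pi.single i 1} := freeCorr_le_plusCorr hβ.le le_rfl _
      _ ≤ plusCorr d β h {0, Pi.single i 1} := plusCorr_mono_params hβ.le le_rfl le_rfl hh _
  haveI : Nonempty (Fin d) := ⟨⟨0, hd⟩⟩
  exact sum_pos (fun i _ => hi i) univ_nonempty

/-! ### Strict monotonicity in `β` -/

/-- **`β ↦ ψ(β,h)` IS STRICTLY INCREASING ON `[0,∞)` FOR EVERY `h`** (`d ≥ 1`): between `a < b` insert `c = (a+b)/2 > 0`;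
`ψ(c,h) ≥ ψ(a,h)` (monotone) and `ψ(b,h) − ψ(c,h) ≥ (b − c)(Σᵢ ⟨σ_0σ_{eᵢ}⟩⁺_{c,|h|} + |h|⟨σ_0⟩⁺_{c,|h|}) > 0`.
[cite: FriedliVelenik2017, Exercise 3.12 and Thm. 3.6; Griffiths1967] -/
theorem strictMonoOn_pressure_beta_field (hd : 1 ≤ d) (h : ℝ) : StrictMonoOn (fun b => pressure d b h) (Ici 0) := by
  -- reduce to `h ≥ 0` by `ψ(β,−h) = ψ(β,h)`
  suffices H : ∀ {t : ℝ}, 0 ≤ t → StrictMonoOn (fun b => pressure d b t) (Ici 0) by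
    rcases le_or_gt 0 h with hh | hh
    · exact H hh
    · have hfun : (fun b => pressure d b h) = fun b => pressure d b (-h) := funext fun b => (pressure_neg_field b h).symm
      rw [hfun]
      exact H (neg_nonneg.2 hh.le)
  intro t ht a ha b _ hab
  have ha0 : 0 ≤ a := ha
  set c := (a + b) / 2 with hc
  have hac : a ≤ c := by rw [hc]; linarith
  have hcb : c < b := by rw [hc]; linarith
  have hc0 : 0 < c := by rw [hc]; linarith
  have h1 : pressure d a t ≤ pressure d c t := monotoneOn_pressure_beta_field (d := d) t ha (mem_Ici.2 hc0.le) hac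
  have h2 := (slope_pressure_beta_mem_Icc_field (d := d) hc0.le hcb ht).1
  rw [slope_def_field, le_div_iff₀ (sub_pos.2 hcb)] at h2
  have hpos : 0 < ∑ i, plusCorr d c t {0, Pi.single i 1} + t * plusCorr d c t {0} :=
    add_pos_of_pos_of_nonneg (sum_plusCorr_nn_pos hd hc0 ht) (mul_nonneg ht (plusCorr_nonneg hc0.le ht _))
  dsimp only
  nlinarith [mul_pos (sub_pos.2 hcb) hpos]

/-- **`log 2 < ψ(β,h)` for every `β > 0` and every real `h`** (`d ≥ 1`; `ψ(0,h) = log 2` and strict monotonicity in `β`).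
[cite: FriedliVelenik2017, Thm. 3.6 and Exercise 3.12] -/
theorem log_two_lt_pressure (hd : 1 ≤ d) {β : ℝ} (hβ : 0 < β) (h : ℝ) : Real.log 2 < pressure d β h := by
  have h0 : pressure d 0 h = Real.log 2 :=
    tendsto_nhds_unique ((IsingEnergyDensity.continuous_pressure_beta (d := d) h).tendsto 0)
      (tendsto_pressure_nhds_zero_beta (d := d) h)
  rw [← h0]
  exact strictMonoOn_pressure_beta_field hd h (mem_Ici.2 le_rfl) (mem_Ici.2 hβ.le) hβ

/-- **`ψ(β',h) < ψ(β,h)` for `0 ≤ β' < β`** (every `h`, `d ≥ 1`). [cite: FriedliVelenik2017, Exercise 3.12 and Thm. 3.6] -/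
theorem pressure_lt_pressure_of_lt_beta (hd : 1 ≤ d) {β' β : ℝ} (hβ' : 0 ≤ β') (hlt : β' < β) (h : ℝ) :
    pressure d β' h < pressure d β h :=
  strictMonoOn_pressure_beta_field hd h (mem_Ici.2 hβ') (mem_Ici.2 (hβ'.trans hlt.le)) hlt

/-! ### Strict monotonicity in `|h|` -/

/-- **`h ↦ ψ(β,h)` IS STRICTLY INCREASING ON `[0,∞)` FOR `β > 0`** (`d ≥ 1`): between `s < t` insert `c = (s+t)/2 > 0`;
`ψ(c) ≥ ψ(s)` and `ψ(t) − ψ(c) ≥ (t − c) β m(β,c) ≥ (t − c) β tanh(βc) > 0`. [cite: FriedliVelenik2017, Thm. 3.43 and §3.7] -/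
theorem strictMonoOn_pressure_field_Ici (hd : 1 ≤ d) {β : ℝ} (hβ : 0 < β) :
    StrictMonoOn (fun t => pressure d β t) (Ici 0) := by
  intro s hs t _ hst
  have hs0 : 0 ≤ s := hs
  set c := (s + t) / 2 with hc
  have hsc : s ≤ c := by rw [hc]; linarith
  have hct : c < t := by rw [hc]; linarith
  have hc0 : 0 < c := by rw [hc]; linarith
  have h1 : pressure d β s ≤ pressure d β c := monotoneOn_pressure_field_abs (d := d) β hs (mem_Ici.2 hc0.le) hsc
  have h2 := mul_magnetizationInField_le_slope_pressure (d := d) hd hβ.le hc0 hct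
  rw [slope_def_field, le_div_iff₀ (sub_pos.2 hct)] at h2
  have hm : 0 < magnetizationInField d β c := by
    refine lt_of_lt_of_le ?_ (tanh_mul_le_magnetizationInField hβ hc0.le)
    have hx : 0 < β * c := mul_pos hβ hc0
    rw [Real.tanh_eq_sinh_div_cosh]
    exact div_pos (Real.sinh_pos_iff.2 hx) (Real.cosh_pos _)
  dsimp only
  nlinarith [mul_pos (sub_pos.2 hct) (mul_pos hβ hm)]

/-- **`ψ(β,h₁) < ψ(β,h₂)` whenever `|h₁| < |h₂|`** (`β > 0`, `d ≥ 1`): the pressure depends on the field only through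
`|h|` and increases STRICTLY with it. [cite: FriedliVelenik2017, Thm. 3.43 and §3.7.1] -/
theorem pressure_lt_pressure_of_abs_lt (hd : 1 ≤ d) {β : ℝ} (hβ : 0 < β) {h₁ h₂ : ℝ} (h12 : |h₁| < |h₂|) :
    pressure d β h₁ < pressure d β h₂ := by
  have e1 : pressure d β h₁ = pressure d β |h₁| := by
    rcases le_or_gt 0 h₁ with h | h
    · rw [abs_of_nonneg h]
    · rw [abs_of_neg h, pressure_neg_field]
  have e2 : pressure d β h₂ = pressure d β |h₂| := by
    rcases le_or_gt 0 h₂ with h | h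
    · rw [abs_of_nonneg h]
    · rw [abs_of_neg h, pressure_neg_field]
  rw [e1, e2]
  exact strictMonoOn_pressure_field_Ici hd hβ (mem_Ici.2 (abs_nonneg _)) (mem_Ici.2 (abs_nonneg _)) h12

/-- **`ψ(β,0) < ψ(β,h)` for `β > 0`, `h ≠ 0`** (`d ≥ 1`). [cite: FriedliVelenik2017, Thm. 3.43 and §3.7.1] -/
theorem pressure_zero_field_lt_pressure (hd : 1 ≤ d) {β h : ℝ} (hβ : 0 < β) (hh : h ≠ 0) :
    pressure d β 0 < pressure d β h :=
  pressure_lt_pressure_of_abs_lt hd hβ (by simpa using abs_pos.2 hh)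

/-- **`ψ(β,·)` is injective on `[0,∞)`** (`β > 0`, `d ≥ 1`): distinct nonnegative fields have distinct pressures.
[cite: FriedliVelenik2017, Thm. 3.43] -/
theorem pressure_injOn_field_Ici (hd : 1 ≤ d) {β : ℝ} (hβ : 0 < β) : InjOn (fun t => pressure d β t) (Ici 0) :=
  (strictMonoOn_pressure_field_Ici hd hβ).injOn

/-- **`ψ(β,h₁) = ψ(β,h₂) ↔ |h₁| = |h₂|`** for `β > 0` (`d ≥ 1`). [cite: FriedliVelenik2017, Thm. 3.43 and §3.7.1] -/
theorem pressure_eq_pressure_iff_abs_eq (hd : 1 ≤ d) {β : ℝ} (hβ : 0 < β) (h₁ h₂ : ℝ) :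
    pressure d β h₁ = pressure d β h₂ ↔ |h₁| = |h₂| := by
  constructor
  · intro heq
    rcases lt_trichotomy |h₁| |h₂| with hlt | he | hgt
    · exact absurd heq (pressure_lt_pressure_of_abs_lt hd hβ hlt).ne
    · exact he
    · exact absurd heq (pressure_lt_pressure_of_abs_lt hd hβ hgt).ne'
  · intro he
    have e1 : pressure d β h₁ = pressure d β |h₁| := by
      rcases le_or_gt 0 h₁ with h | h
      · rw [abs_of_nonneg h]
      · rw [abs_of_neg h, pressure_neg_field]
    have e2 : pressure d β h₂ = pressure d β |h₂| := by
      rcases le_or_gt 0 h₂ with h | h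
      · rw [abs_of_nonneg h]
      · rw [abs_of_neg h, pressure_neg_field]
    rw [e1, e2, he]

end IsingPressure

end Summit.CriticalPhenomena.PercolationContinuityZ3.Theorems.FK

end
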